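import Literature.Probability.LatticeModels.GreenFunctionConformalRadiusProofs
import Literature.Probability.LatticeModels.LatticePotentialKernelRate
import HarnessLib

/-!
# Logarithmic bounds for the Green's function of simple random walk killed outside a finite
# planar set (Lawler 1991, Thm. 1.6.6 and Prop. 1.6.7, for general sets)

Topic `Literature/Probability/LatticeModels`; discrete potential theory on `ℤ²` in the vocabulary
of `GreenFunctionConformalRadius.lean` (`SRW.killedGreen (ChordalLERW.siteGraph A) x y` = expected
number of visits to `y`, time `0` included, of simple random walk from `x` before leaving the finite
set `A`; `KozdronLawler.greenConst = k₀ = (2γ + 3 log 2)/π`). From the last-exit identity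
`G_A(x,0) = 2(Σ_{z ∈ ∂A} H_A(x,z) a(z) - a(x))` (`a` the potential kernel with `Δ a = 2δ₀`,
`H_A` the exit distribution) and the quantitative expansion
`|a(z) - (1/π) log |z| - k₀/2| ≤ C/|z|` (`LatticePotentialKernelRate.lean`) one reads off, for ANY
finite `A ∋ 0` whose exit points `z ∈ ∂A` all satisfy `r ≤ |z| ≤ R` (`r ≥ 1`):

* `KozdronLawler.killedGreen_eq_two_mul_sum_sub` — `G_A(x,0) = 2(Σ_z H_A(x,z) a(z) - a(x))`
  (`x ∈ A`);
* `KozdronLawler.killedGreen_origin_log_bounds` — **`(2/π) log r + k₀ - C/r ≤ G_A(0,0) ≤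
  (2/π) log R + k₀ + C/r`**; for the lattice disc `C_n = {|z| < n}` (`r = n`, `R ≤ n + 1`) this is
  Lawler's Theorem 1.6.6, `G_{C_n}(0) = (2/π) log n + k₀ + O(n⁻¹)`;
* `KozdronLawler.killedGreen_pole_log_bounds` — **`(2/π)(log r - log |x|) - C/r - C/|x| ≤ G_A(x,0) ≤
  (2/π)(log R - log |x|) + C/r + C/|x|`** for `x ∈ A ∖ {0}`; for `C_n` this is Lawler's
  Proposition 1.6.7, `G_{C_n}(x) = (2/π)(log n - log |x|) + O(|x|⁻¹ + n⁻¹)`.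

(In Lawler's normalisation `G` counts visits of the simple random walk exactly as `SRW.killedGreen`
does, and his `a = 2 ·` ours, `k = k₀`.) These are the Green's function inputs of the discrete
Beurling estimate (Lawler 1991, Thm. 2.5.2, eq. (2.51)) on the path to Kozdron–Lawler's Lemma 3.4.
No named fact is introduced.

## References

* G. F. Lawler, *Intersections of Random Walks* (1991), Thm. 1.6.6, Prop. 1.6.7 [Lawler1991].
* M. J. Kozdron, G. F. Lawler, Electron. J. Probab. 10 (2005), §2.3 (15)–(16) [KozdronLawler2005].
-/

noncomputable section

open Finset
open Literature.Probability.RandomPlanarGeometry (ChordalLERW.siteGraph)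

namespace Literature.Probability.LatticeModels

namespace KozdronLawler

/-- **Last-exit identity with a general starting point**: for finite `A ∋ 0` and `x ∈ A`,
`G_A(x,0) = 2(Σ_{z ∈ ∂A} H_A(x,z) a(z) - a(x))` — optional stopping of `a(S)` off the origin
(`green_representation` with `F = a`, `Δ a = 2δ₀`, and `G = 4 · dirichletGreen`).
[cite: KozdronLawler2005, §2.3 eq. (15)] -/
theorem killedGreen_eq_two_mul_sum_sub (A : Finset (Site 2)) (h0 : (0 : Site 2) ∈ A) {x : Site 2}
    (hx : x ∈ A) :
    SRW.killedGreen (ChordalLERW.siteGraph (↑A : Set (Site 2))) x 0 =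
      2 * ((∑ z ∈ outerBoundary (zdGraph 2) A, poissonKernel A x z * latticePotentialKernel 2 z) -
        latticePotentialKernel 2 x) := by
  classical
  have hrep := green_representation (by norm_num : 0 < 2) A (latticePotentialKernel 2) hx
  have hlap : ∀ y, dirichletGreen A x y * -latticeLaplacianZd (latticePotentialKernel 2) y =
      if (0 : Site 2) = y then -(2 * dirichletGreen A x 0) else 0 := by
    intro y
    rw [latticeLaplacianZd_latticePotentialKernel 2 (by norm_num) y]
    by_cases hy : (0 : Site 2) = y
    · subst hy; simp; ring
    · have hy' : y ≠ 0 := fun h => hy h.symm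
      rw [if_neg hy', if_neg hy]; ring
  simp_rw [hlap] at hrep
  rw [Finset.sum_ite_eq, if_pos h0] at hrep
  rw [killedGreen_siteGraph_eq_four_mul_dirichletGreen A h0 x]
  linarith

/-- The potential kernel on an annulus of exit points: if `r ≤ |z| ≤ R`, `r ≥ 1`, and
`|a(z) - (1/π) log|z| - k₀/2| ≤ C₀/|z|`, then
`(1/π) log r + k₀/2 - |C₀|/r ≤ a(z) ≤ (1/π) log R + k₀/2 + |C₀|/r`. [folklore] -/
theorem potentialKernel_mem_of_annulus {C₀ r R : ℝ} (hr : 1 ≤ r)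
    (hC₀ : ∀ x : Site 2, x ≠ 0 →
      |latticePotentialKernel 2 x - 1 / Real.pi * Real.log ‖Site.toComplex x‖ - greenConst / 2| ≤
        C₀ / ‖Site.toComplex x‖)
    {z : Site 2} (hrz : r ≤ ‖Site.toComplex z‖) (hzR : ‖Site.toComplex z‖ ≤ R) :
    1 / Real.pi * Real.log r + greenConst / 2 - |C₀| / r ≤ latticePotentialKernel 2 z ∧
      latticePotentialKernel 2 z ≤ 1 / Real.pi * Real.log R + greenConst / 2 + |C₀| / r := by
  have hπ := Real.pi_pos
  have hr0 : 0 < r := by linarith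
  have hzpos : 0 < ‖Site.toComplex z‖ := by linarith
  have hz0 : z ≠ 0 := by
    rintro rfl
    have : ‖Site.toComplex (0 : Site 2)‖ = 0 := by
      rw [norm_eq_zero]
      apply Complex.ext <;> simp [Site.toComplex]
    linarith
  have hrate := abs_le.1 ((hC₀ z hz0).trans
    ((div_le_div_of_nonneg_right (le_abs_self C₀) hzpos.le).trans
      (div_le_div_of_nonneg_left (abs_nonneg _) hr0 hrz)))
  have hlog1 : Real.log r ≤ Real.log ‖Site.toComplex z‖ := Real.log_le_log hr0 hrz
  have hlog2 : Real.log ‖Site.toComplex z‖ ≤ Real.log R := Real.log_le_log hzpos hzR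
  have hπ' : 0 < 1 / Real.pi := by positivity
  constructor <;> nlinarith [mul_le_mul_of_nonneg_left hlog1 hπ'.le,
    mul_le_mul_of_nonneg_left hlog2 hπ'.le, hrate.1, hrate.2]

/-- **`G_A(0,0) = (2/π) log(dist(0,∂A)) + k₀ + O(1/dist)`, two-sided** (Lawler 1991, Thm. 1.6.6 for
the disc): there is `C` such that for every finite `A ∋ 0` whose exit points all satisfy
`r ≤ |z| ≤ R` with `r ≥ 1`,
`(2/π) log r + k₀ - C/r ≤ G_A(0,0) ≤ (2/π) log R + k₀ + C/r`. [cite: Lawler1991, Thm. 1.6.6] -/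
theorem killedGreen_origin_log_bounds : ∃ C : ℝ, ∀ A : Finset (Site 2), (0 : Site 2) ∈ A →
    ∀ r R : ℝ, 1 ≤ r →
      (∀ z ∈ outerBoundary (zdGraph 2) A, r ≤ ‖Site.toComplex z‖ ∧ ‖Site.toComplex z‖ ≤ R) →
      2 / Real.pi * Real.log r + greenConst - C / r ≤
          SRW.killedGreen (ChordalLERW.siteGraph (↑A : Set (Site 2))) 0 0 ∧
        SRW.killedGreen (ChordalLERW.siteGraph (↑A : Set (Site 2))) 0 0 ≤
          2 / Real.pi * Real.log R + greenConst + C / r := by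
  obtain ⟨C₀, hC₀⟩ := latticePotentialKernel_two_rate
  refine ⟨2 * |C₀|, fun A h0 r R hr hann => ?_⟩
  set S := outerBoundary (zdGraph 2) A with hS
  set H : Site 2 → ℝ := fun z => poissonKernel A 0 z with hH
  have hG := killedGreen_origin_eq_sum_poissonKernel_mul_potentialKernel A h0
  have hSH : ∑ z ∈ S, H z = 1 := sum_poissonKernel_eq_one A h0
  have hH0 : ∀ z, 0 ≤ H z := fun z => poissonKernel_nonneg (by norm_num) A 0 z
  have hz : ∀ z ∈ S,
      1 / Real.pi * Real.log r + greenConst / 2 - |C₀| / r ≤ latticePotentialKernel 2 z ∧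
        latticePotentialKernel 2 z ≤ 1 / Real.pi * Real.log R + greenConst / 2 + |C₀| / r :=
    fun z hzS => potentialKernel_mem_of_annulus hr hC₀ (hann z hzS).1 (hann z hzS).2
  -- average against `H ≥ 0`, `Σ H = 1`
  have hlow : ∑ z ∈ S, H z * (1 / Real.pi * Real.log r + greenConst / 2 - |C₀| / r) ≤
      ∑ z ∈ S, H z * latticePotentialKernel 2 z :=
    Finset.sum_le_sum fun z hzS => mul_le_mul_of_nonneg_left (hz z hzS).1 (hH0 z)
  have hupp : ∑ z ∈ S, H z * latticePotentialKernel 2 z ≤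
      ∑ z ∈ S, H z * (1 / Real.pi * Real.log R + greenConst / 2 + |C₀| / r) :=
    Finset.sum_le_sum fun z hzS => mul_le_mul_of_nonneg_left (hz z hzS).2 (hH0 z)
  rw [← Finset.sum_mul, hSH, one_mul] at hlow hupp
  rw [hG]
  constructor
  · calc 2 / Real.pi * Real.log r + greenConst - 2 * |C₀| / r
        = 2 * (1 / Real.pi * Real.log r + greenConst / 2 - |C₀| / r) := by ring
      _ ≤ 2 * ∑ z ∈ S, H z * latticePotentialKernel 2 z := by linarith
  · calc 2 * ∑ z ∈ S, H z * latticePotentialKernel 2 z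
        ≤ 2 * (1 / Real.pi * Real.log R + greenConst / 2 + |C₀| / r) := by linarith
      _ = 2 / Real.pi * Real.log R + greenConst + 2 * |C₀| / r := by ring

/-- **`G_A(x,0) = (2/π)(log dist(0,∂A) - log |x|) + O(1/|x| + 1/dist)`, two-sided** (Lawler 1991,
Prop. 1.6.7 for the disc): there is `C` such that for every finite `A ∋ 0`, every `x ∈ A ∖ {0}`, and
all `r ≥ 1`, `R` with `r ≤ |z| ≤ R` for every exit point `z ∈ ∂A`,
`(2/π)(log r - log |x|) - C/r - C/|x| ≤ G_A(x,0) ≤ (2/π)(log R - log |x|) + C/r + C/|x|`.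
[cite: Lawler1991, Prop. 1.6.7] -/
theorem killedGreen_pole_log_bounds : ∃ C : ℝ, ∀ A : Finset (Site 2), (0 : Site 2) ∈ A →
    ∀ x ∈ A, x ≠ 0 → ∀ r R : ℝ, 1 ≤ r →
      (∀ z ∈ outerBoundary (zdGraph 2) A, r ≤ ‖Site.toComplex z‖ ∧ ‖Site.toComplex z‖ ≤ R) →
      2 / Real.pi * (Real.log r - Real.log ‖Site.toComplex x‖) - C / r - C / ‖Site.toComplex x‖ ≤
          SRW.killedGreen (ChordalLERW.siteGraph (↑A : Set (Site 2))) x 0 ∧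
        SRW.killedGreen (ChordalLERW.siteGraph (↑A : Set (Site 2))) x 0 ≤
          2 / Real.pi * (Real.log R - Real.log ‖Site.toComplex x‖) + C / r + C / ‖Site.toComplex x‖ := by
  obtain ⟨C₀, hC₀⟩ := latticePotentialKernel_two_rate
  refine ⟨2 * |C₀|, fun A h0 x hx hx0 r R hr hann => ?_⟩
  set S := outerBoundary (zdGraph 2) A with hS
  set H : Site 2 → ℝ := fun z => poissonKernel A x z with hH
  have hG := killedGreen_eq_two_mul_sum_sub A h0 hx
  have hSH : ∑ z ∈ S, H z = 1 := sum_poissonKernel_eq_one A hx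
  have hH0 : ∀ z, 0 ≤ H z := fun z => poissonKernel_nonneg (by norm_num) A x z
  -- the pole term: `|a(x) - (1/π) log |x| - k₀/2| ≤ |C₀|/|x|`
  have hxpos : 0 < ‖Site.toComplex x‖ := by
    refine norm_pos_iff.2 fun h => hx0 ?_
    ext i
    fin_cases i
    · have := congrArg Complex.re h; simpa using this
    · have := congrArg Complex.im h; simpa using this
  have hax := abs_le.1 ((hC₀ x hx0).trans (div_le_div_of_nonneg_right (le_abs_self C₀) hxpos.le))
  have hz : ∀ z ∈ S,
      1 / Real.pi * Real.log r + greenConst / 2 - |C₀| / r ≤ latticePotentialKernel 2 z ∧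
        latticePotentialKernel 2 z ≤ 1 / Real.pi * Real.log R + greenConst / 2 + |C₀| / r :=
    fun z hzS => potentialKernel_mem_of_annulus hr hC₀ (hann z hzS).1 (hann z hzS).2
  have hlow : ∑ z ∈ S, H z * (1 / Real.pi * Real.log r + greenConst / 2 - |C₀| / r) ≤
      ∑ z ∈ S, H z * latticePotentialKernel 2 z :=
    Finset.sum_le_sum fun z hzS => mul_le_mul_of_nonneg_left (hz z hzS).1 (hH0 z)
  have hupp : ∑ z ∈ S, H z * latticePotentialKernel 2 z ≤
      ∑ z ∈ S, H z * (1 / Real.pi * Real.log R + greenConst / 2 + |C₀| / r) :=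
    Finset.sum_le_sum fun z hzS => mul_le_mul_of_nonneg_left (hz z hzS).2 (hH0 z)
  rw [← Finset.sum_mul, hSH, one_mul] at hlow hupp
  rw [hG]
  constructor
  · calc 2 / Real.pi * (Real.log r - Real.log ‖Site.toComplex x‖) - 2 * |C₀| / r -
          2 * |C₀| / ‖Site.toComplex x‖
        = 2 * ((1 / Real.pi * Real.log r + greenConst / 2 - |C₀| / r) -
            (1 / Real.pi * Real.log ‖Site.toComplex x‖ + greenConst / 2 +
              |C₀| / ‖Site.toComplex x‖)) := by ring
      _ ≤ 2 * ((∑ z ∈ S, H z * latticePotentialKernel 2 z) - latticePotentialKernel 2 x) := by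
          linarith [hax.2]
  · calc 2 * ((∑ z ∈ S, H z * latticePotentialKernel 2 z) - latticePotentialKernel 2 x)
        ≤ 2 * ((1 / Real.pi * Real.log R + greenConst / 2 + |C₀| / r) -
            (1 / Real.pi * Real.log ‖Site.toComplex x‖ + greenConst / 2 -
              |C₀| / ‖Site.toComplex x‖)) := by linarith [hax.1]
      _ = 2 / Real.pi * (Real.log R - Real.log ‖Site.toComplex x‖) + 2 * |C₀| / r +
          2 * |C₀| / ‖Site.toComplex x‖ := by ring

end KozdronLawler

end Literature.Probability.LatticeModels

end
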